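import Summits.RiemannHypothesis.RiemannHypothesis.Theorems.HandoffSemilocalDilation
import Summits.RiemannHypothesis.RiemannHypothesis.Theorems.HandoffMarginLaw
import Summits.RiemannHypothesis.RiemannHypothesis.Theorems.HandoffLadderRungs
import HarnessLib

/-!
# HANDOFF — SECTOR continuity of the semi-local ground energies, and strict wall offsets from certified rungs (cell rh-explicit, TRACK «HANDOFF», seat theory-2)

HONEST FRAMING. Nothing here bears on the truth of RH. Two additions to theory-1's files XI-a/XI-b (`HandoffSemilocalDilation`, whose uniform modulus
`exists_semilocalDilate_modulus` is the only analytic input imported here, and `HandoffSemilocalContinuity`: continuity of the unconstrained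
semi-local bottom `t ↦ λ_min(S; t)`), for the interface of HANDOFF-STATEMENT §H.2 / §H.4:

* §1 continuity of `t ↦ λ_min(S; t; P)` for EVERY dilation-stable sector `P` with nonempty spheres — in particular the EVEN and
  the ODD semi-local ground energies (§H.2: `ε = min(ε_ev, ε_od)`; «odd carries the wall, even carries the margin» is DATA about the two
  sector curves, each of which is now a continuous function of the bandwidth) — by the same two-way dilation of near-minimisers through
  XI-a's uniform modulus `exists_semilocalDilate_modulus` (dilations preserve parity); and continuity of the aggregate deficit `b ↦ D_q(b)`.
* §2 **strict wall offsets from certified rungs** (RH-free): `0 < ε((log q)/2) ⟹ 0 < δ*(q)` (`q` prime; on the old cone the `{p < q}`-form IS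
  Weil's form, XI-b's `lt_weilSemilocalThreshold_of_semilocalGroundEnergy_pos`), hence the CERTIFICATE shape
  `0 < ε_ev(c) → 0 < ε_od(c) → q ≤ e^{2c} → 0 < δ*(q)`: a two-sector bracket with STRICTLY positive lower ends at bandwidth `c` forces the
  wall of every `{p < q}`-form with `q ≤ e^{2c}` strictly beyond `(log q)/2` — the A1 ⟹ A4 direction of the cell's record («every measured wall
  offset is positive») as a kernel implication; rows `c = 3/2 ↦ q ≤ 19`, `c = 8/5 ↦ q ≤ 23`, `c = 17/10 ↦ q ≤ 29`, `c = 2 ↦ q ≤ 53`.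
  The hypotheses are certificate shapes (custodian-VERIFIED DATA objects in HOME/EXTREMALS supply them numerically); nothing here certifies them.

References: M. Suzuki, arXiv:2606.09096 Thm. 1.3 (`Suzuki2026`, mechanism); H. Yoshida, Adv. Stud. Pure Math. 21 (1992) Prop. 6 (p. 320)
(`Yoshida1992HermitianForms`); E. Bombieri, Rend. Mat. Acc. Lincei (9) 11 (2000) §4 (`Bombieri2000Weil`).
-/

set_option linter.dupNamespace false  -- the mandated namespace repeats `RiemannHypothesis`

noncomputable section

open Set Filter Topology Complex MeasureTheory Literature.NumberTheory.LFunctions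
open Summit.RiemannHypothesis.RiemannHypothesis.Theorems
open Summit.RiemannHypothesis.RiemannHypothesis.Theorems.HandoffSemilocalEnergy
open Summit.RiemannHypothesis.RiemannHypothesis.Theorems.HandoffMarginLaw
open Summit.RiemannHypothesis.RiemannHypothesis.Theorems.HandoffLadderRungs (natCast_le_exp_of_pow_lt log_half_le_of_le_exp)
open Summit.RiemannHypothesis.RiemannHypothesis.Theorems.MotivicDoor.SemilocalThreshold
open scoped Real

namespace Summit.RiemannHypothesis.RiemannHypothesis.Theorems.HandoffSemilocalSectorContinuity

variable {g : ℝ → ℂ} {S : Finset ℕ} {P : (ℝ → ℂ) → Prop} {a : ℝ} {q : ℕ}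

/-! ## §1  Continuity in every dilation-stable sector -/

/-- Near-minimisers of the semi-local form on a nonempty constrained sphere. [folklore] -/
theorem exists_re_weilSemilocalQuadratic_lt_of_nonempty (hne : (semilocalSphereValues S P a).Nonempty) {ε : ℝ}
    (hε : 0 < ε) :
    ∃ g : ℝ → ℂ, IsWeilTest g ∧ tsupport g ⊆ Icc (-a) a ∧ P g ∧ ∫ t : ℝ, ‖g t‖ ^ 2 = (1 : ℝ) ∧
      (weilSemilocalQuadratic S g).re < semilocalGroundEnergy S P a + ε := by
  obtain ⟨x, ⟨g, hg, hs, hP, hn, rfl⟩, hlt⟩ := exists_lt_of_csInf_lt hne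
    (lt_add_of_pos_right (semilocalGroundEnergy S P a) hε)
  exact ⟨g, hg, hs, hP, hn, hlt⟩

/-- **Continuity of `t ↦ λ_min(S; t; P)` at every `a₀ > 0`**, for every finite `S` and every sector `P` stable under the dilations
`weilDilate η` (`η > −1`) with nonempty spheres on all windows: upper bound by dilating a near-minimiser of the window `a₀` into the window
`a`, lower bound by dilating every energy-bounded element of the sphere of `a ≤ 2a₀` into `a₀`, both through XI-a's uniform modulus
`exists_semilocalDilate_modulus`. [cite: Suzuki2026, Thm. 1.3 (mechanism), primes restricted to S, sector-constrained] -/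
theorem continuousAt_semilocalGroundEnergy_of_dilateStable (S : Finset ℕ) (P : (ℝ → ℂ) → Prop)
    (hP : ∀ (η : ℝ) (g : ℝ → ℂ), -1 < η → P g → P (weilDilate η g))
    (hne : ∀ a : ℝ, 0 < a → (semilocalSphereValues S P a).Nonempty) {a₀ : ℝ} (ha₀ : 0 < a₀) :
    ContinuousAt (semilocalGroundEnergy S P) a₀ := by
  rw [Metric.continuousAt_iff]
  intro ε hε
  obtain ⟨g₀, hg₀, hs₀, hP₀, hn₀, hlt⟩ := exists_re_weilSemilocalQuadratic_lt_of_nonempty (hne a₀ ha₀) (half_pos hε)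
  obtain ⟨δ₁, hδ₁, -, h₁⟩ :=
    exists_semilocalDilate_modulus S ha₀ ((weilSemilocalQuadratic S g₀).re) (half_pos hε)
  obtain ⟨δ₂, hδ₂, -, h₂⟩ :=
    exists_semilocalDilate_modulus S (a := 2 * a₀) (by positivity) (semilocalGroundEnergy S P a₀ + 1) (half_pos hε)
  refine ⟨min (a₀ / 2) (min (δ₁ * a₀ / 2) (δ₂ * a₀ / 2)), by positivity, fun a ha ↦ ?_⟩
  rw [Real.dist_eq] at ha ⊢
  have ha1 : |a - a₀| < a₀ / 2 := lt_of_lt_of_le ha (min_le_left _ _)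
  have ha2 : |a - a₀| < δ₁ * a₀ / 2 := lt_of_lt_of_le ha ((min_le_right _ _).trans (min_le_left _ _))
  have ha3 : |a - a₀| < δ₂ * a₀ / 2 := lt_of_lt_of_le ha ((min_le_right _ _).trans (min_le_right _ _))
  rw [abs_lt] at ha1 ha2 ha3
  have hapos : a₀ / 2 < a := by linarith [ha1.1]
  have ha0 : 0 < a := by linarith
  have hale : a ≤ 2 * a₀ := by linarith [ha1.2]
  rw [abs_sub_lt_iff]
  constructor
  · -- upper bound: `λ(a) < λ(a₀) + ε`
    set η : ℝ := a₀ / a - 1 with hη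
    have hη1 : -1 < η := by
      have : 0 < a₀ / a := div_pos ha₀ ha0
      rw [hη]; linarith
    have hηabs : |η| ≤ δ₁ := by
      rw [hη, show a₀ / a - 1 = (a₀ - a) / a by field_simp, abs_div, abs_of_pos ha0,
        div_le_iff₀ ha0, abs_sub_comm]
      nlinarith [ha2.1, ha2.2, abs_lt.2 ⟨ha2.1, ha2.2⟩]
    have hwin : a₀ / (1 + η) = a := by
      rw [show 1 + η = a₀ / a by rw [hη]; ring, div_div_eq_mul_div, mul_div_cancel_left₀ _ ha₀.ne']
    have hh : IsWeilTest (weilDilate η g₀) := hg₀.weilDilate hη1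
    have hhs : tsupport (weilDilate η g₀) ⊆ Icc (-a) a := by
      have := tsupport_weilDilate_subset g₀ hη1 hs₀
      rwa [hwin] at this
    have hhn : ∫ t : ℝ, ‖weilDilate η g₀ t‖ ^ 2 = 1 := by
      rw [integral_norm_sq_weilDilate g₀ hη1, hn₀]
    have hle := semilocalGroundEnergy_le_re (S := S) hh hhs (hP η g₀ hη1 hP₀) hhn
    have hkey := h₁ η hηabs g₀ hg₀ hs₀ hn₀ le_rfl
    rw [abs_le] at hkey
    linarith [hkey.2]
  · -- lower bound: `λ(a₀) − ε < λ(a)`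
    have hlb : semilocalGroundEnergy S P a₀ - ε / 2 ≤ semilocalGroundEnergy S P a := by
      refine le_semilocalGroundEnergy (hne a ha0) fun h hh hhs hPh hhn ↦ ?_
      by_cases hE : (weilSemilocalQuadratic S h).re ≤ semilocalGroundEnergy S P a₀ + 1
      · set η : ℝ := a / a₀ - 1 with hη
        have hη1 : -1 < η := by
          have : 0 < a / a₀ := div_pos ha0 ha₀
          rw [hη]; linarith
        have hηabs : |η| ≤ δ₂ := by
          rw [hη, show a / a₀ - 1 = (a - a₀) / a₀ by field_simp, abs_div, abs_of_pos ha₀,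
            div_le_iff₀ ha₀]
          nlinarith [ha3.1, ha3.2, abs_lt.2 ⟨ha3.1, ha3.2⟩]
        have hwin : a / (1 + η) = a₀ := by
          rw [show 1 + η = a / a₀ by rw [hη]; ring, div_div_eq_mul_div,
            mul_div_cancel_left₀ _ ha0.ne']
        have hhs' : tsupport h ⊆ Icc (-(2 * a₀)) (2 * a₀) :=
          hhs.trans (Icc_subset_Icc (by linarith) hale)
        have hh' : IsWeilTest (weilDilate η h) := hh.weilDilate hη1
        have hhs'' : tsupport (weilDilate η h) ⊆ Icc (-a₀) a₀ := by
          have := tsupport_weilDilate_subset h hη1 hhs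
          rwa [hwin] at this
        have hhn' : ∫ t : ℝ, ‖weilDilate η h t‖ ^ 2 = 1 := by
          rw [integral_norm_sq_weilDilate h hη1, hhn]
        have hle := semilocalGroundEnergy_le_re (S := S) hh' hhs'' (hP η h hη1 hPh) hhn'
        have hkey := h₂ η hηabs h hh hhs' hhn hE
        rw [abs_le] at hkey
        linarith [hkey.1]
      · have hE' := not_le.1 hE
        linarith
    linarith

/-- Dilations preserve evenness. [folklore] -/
theorem even_weilDilate (η : ℝ) (g : ℝ → ℂ) (_hη : -1 < η) (h : ∀ t, g (-t) = g t) :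
    ∀ t, weilDilate η g (-t) = weilDilate η g t := by
  intro t
  simp only [weilDilate_apply, mul_neg, h]

/-- Dilations preserve oddness. [folklore] -/
theorem odd_weilDilate (η : ℝ) (g : ℝ → ℂ) (_hη : -1 < η) (h : ∀ t, g (-t) = -g t) :
    ∀ t, weilDilate η g (-t) = -weilDilate η g t := by
  intro t
  simp only [weilDilate_apply, mul_neg, h, mul_neg]

/-- **The EVEN-sector semi-local ground energy `t ↦ λ_min(S; t; even)` is continuous on `(0, ∞)`.** [cite: Suzuki2026, Thm. 1.3 (mechanism), primes restricted to S, even sector] -/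
theorem continuousAt_semilocalGroundEnergy_even (S : Finset ℕ) {a₀ : ℝ} (ha₀ : 0 < a₀) :
    ContinuousAt (semilocalGroundEnergy S (fun g ↦ ∀ t, g (-t) = g t)) a₀ :=
  continuousAt_semilocalGroundEnergy_of_dilateStable S _ even_weilDilate
    (fun _ ha ↦ semilocalSphereValues_even_nonempty S ha) ha₀

/-- **The ODD-sector semi-local ground energy `t ↦ λ_min(S; t; odd)` is continuous on `(0, ∞)`.** [cite: Suzuki2026, Thm. 1.3 (mechanism), primes restricted to S, odd sector] -/
theorem continuousAt_semilocalGroundEnergy_odd (S : Finset ℕ) {a₀ : ℝ} (ha₀ : 0 < a₀) :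
    ContinuousAt (semilocalGroundEnergy S (fun g ↦ ∀ t, g (-t) = -g t)) a₀ :=
  continuousAt_semilocalGroundEnergy_of_dilateStable S _ odd_weilDilate
    (fun _ ha ↦ semilocalSphereValues_odd_nonempty S ha) ha₀

/-- The even-sector semi-local ground energy is continuous on `(0, ∞)`. [cite: Suzuki2026, Thm. 1.3 (mechanism), primes restricted to S, even sector] -/
theorem continuousOn_semilocalGroundEnergy_even (S : Finset ℕ) :
    ContinuousOn (semilocalGroundEnergy S (fun g ↦ ∀ t, g (-t) = g t)) (Ioi 0) :=
  fun _ ha ↦ (continuousAt_semilocalGroundEnergy_even S ha).continuousWithinAt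

/-- The odd-sector semi-local ground energy is continuous on `(0, ∞)`. [cite: Suzuki2026, Thm. 1.3 (mechanism), primes restricted to S, odd sector] -/
theorem continuousOn_semilocalGroundEnergy_odd (S : Finset ℕ) :
    ContinuousOn (semilocalGroundEnergy S (fun g ↦ ∀ t, g (-t) = -g t)) (Ioi 0) :=
  fun _ ha ↦ (continuousAt_semilocalGroundEnergy_odd S ha).continuousWithinAt

/-- **The aggregate deficit `b ↦ D_q(b)` (HANDOFF-STATEMENT §D/§H.15) is continuous on `(0, ∞)`** (and non-decreasing, `aggregateDeficit_mono`;
it vanishes at the wall, theory-1's XI-b `semilocalGroundEnergy_threshold_eq_zero`). [this track] -/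
theorem continuousAt_aggregateDeficit (q : ℕ) {b₀ : ℝ} (hb₀ : 0 < b₀) : ContinuousAt (aggregateDeficit q) b₀ :=
  (continuousAt_semilocalGroundEnergy_of_dilateStable (Nat.primesBelow q) (fun _ ↦ True) (fun _ _ _ _ ↦ trivial)
    (fun _ ha ↦ semilocalSphereValues_top_nonempty _ ha) hb₀).neg

/-- `D_q` is continuous on `(0, ∞)`. [this track] -/
theorem continuousOn_aggregateDeficit (q : ℕ) : ContinuousOn (aggregateDeficit q) (Ioi 0) :=
  fun _ hb ↦ (continuousAt_aggregateDeficit q hb).continuousWithinAt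

/-! ## §2  Strict wall offsets from certified rungs (RH-free) -/

/-- **A positive bottom at `(log q)/2` pushes the wall of the `{p < q}`-form STRICTLY beyond `(log q)/2`**: `0 < ε((log q)/2) ⟹ 0 < δ*(q)`
(`q` prime). On the old cone the `{p < q}`-form IS Weil's form (`semilocalGroundEnergy_old_cone`), and a strictly positive bottom persists a little
beyond by continuity (§1; theory-1's XI-b `lt_weilSemilocalThreshold_of_semilocalGroundEnergy_pos` is the same step). RH-free; the hypothesis is the shape of a certified lower bracket. [cite: Yoshida1992HermitianForms, Prop. 6 (p. 320); this track] -/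
theorem wallOffset_pos_of_weilGroundEnergy_pos (hq : q.Prime) (hpos : 0 < weilGroundEnergy (Real.log q / 2)) :
    0 < wallOffset q := by
  have hq1 : (1 : ℝ) < q := by exact_mod_cast hq.one_lt
  have hb0 : 0 < Real.log q / 2 := div_pos (Real.log_pos hq1) two_pos
  set S := Nat.primesBelow q with hS
  have hcone := semilocalGroundEnergy_old_cone hq (le_refl (Real.log q / 2))
  have hpos' : 0 < semilocalGroundEnergy S (fun _ ↦ True) (Real.log q / 2) := by
    rw [hS, hcone]; exact hpos
  -- a strictly positive bottom persists on a neighbourhood (continuity, §1 at `P = ⊤`)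
  have hcont := continuousAt_semilocalGroundEnergy_of_dilateStable S (fun _ ↦ True) (fun _ _ _ _ ↦ trivial)
    (fun _ ha ↦ semilocalSphereValues_top_nonempty S ha) hb0
  rw [Metric.continuousAt_iff] at hcont
  obtain ⟨δ, hδ, h⟩ := hcont _ hpos'
  have h1 : dist (Real.log q / 2 + δ / 2) (Real.log q / 2) < δ := by
    rw [Real.dist_eq, show Real.log q / 2 + δ / 2 - Real.log q / 2 = δ / 2 by ring, abs_of_pos (half_pos hδ)]
    linarith
  have h2 := h h1
  rw [Real.dist_eq, abs_lt] at h2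
  have h3 : 0 ≤ semilocalGroundEnergy S (fun _ ↦ True) (Real.log q / 2 + δ / 2) := by linarith [h2.1]
  have h4 : Real.log q / 2 + δ / 2 ≤ weilSemilocalThreshold S :=
    (semilocalGroundEnergy_top_nonneg_iff_le_threshold (S := S) (a := Real.log q / 2 + δ / 2)).1 h3
  rw [wallOffset, ← hS]
  linarith

/-- **CERTIFICATE SHAPE: a two-sector bracket with STRICTLY positive lower ends at bandwidth `c ≥ (log q)/2` gives `δ*(q) > 0`**
(`ε((log q)/2) ≥ ε(c) = min(ε_ev(c), ε_od(c)) > 0`, antitonicity of `ε`). [cite: Bombieri2000Weil, §4 (Problem 2, Thm 5); Yoshida1992HermitianForms Prop. 6 (p. 320)] -/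
theorem wallOffset_pos_of_sector_energies (hq : q.Prime) {c : ℝ} (hc : Real.log q / 2 ≤ c)
    (hev : 0 < weilEvenGroundEnergy c) (hod : 0 < weilOddGroundEnergy c) : 0 < wallOffset q := by
  have hq1 : (1 : ℝ) < q := by exact_mod_cast hq.one_lt
  have hb0 : 0 < Real.log q / 2 := div_pos (Real.log_pos hq1) two_pos
  have hεc : 0 < weilGroundEnergy c := by
    rw [weilGroundEnergy_eq_min_even_odd]
    exact lt_min hev hod
  exact wallOffset_pos_of_weilGroundEnergy_pos hq (lt_of_lt_of_le hεc (weilGroundEnergy_anti hb0 hc))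

/-- **All strict offsets below `e^{2c}` at once**: a strictly positive two-sector bracket at bandwidth `c` gives `0 < δ*(q)` for EVERY prime
`q ≤ B` whenever `B ≤ e^{2c}`. [this track] -/
theorem forall_wallOffset_pos_of_sector_energies {c : ℝ} {B : ℕ} (hBc : (B : ℝ) ≤ Real.exp (2 * c))
    (hev : 0 < weilEvenGroundEnergy c) (hod : 0 < weilOddGroundEnergy c) :
    ∀ q : ℕ, q.Prime → q ≤ B → 0 < wallOffset q := by
  intro q hq hqB
  have h1 : (q : ℝ) ≤ Real.exp (2 * c) := (show (q : ℝ) ≤ B by exact_mod_cast hqB).trans hBc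
  exact wallOffset_pos_of_sector_energies hq (log_half_le_of_le_exp hq.pos h1) hev hod

/-- The same from a STRICT Weil-positivity input `0 < ε(c)`. [this track] -/
theorem forall_wallOffset_pos_of_weilGroundEnergy_pos {c : ℝ} {B : ℕ} (hBc : (B : ℝ) ≤ Real.exp (2 * c))
    (hε : 0 < weilGroundEnergy c) : ∀ q : ℕ, q.Prime → q ≤ B → 0 < wallOffset q := by
  intro q hq hqB
  have hq1 : (1 : ℝ) < q := by exact_mod_cast hq.one_lt
  have hb0 : 0 < Real.log q / 2 := div_pos (Real.log_pos hq1) two_pos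
  have h1 : (q : ℝ) ≤ Real.exp (2 * c) := (show (q : ℝ) ≤ B by exact_mod_cast hqB).trans hBc
  exact wallOffset_pos_of_weilGroundEnergy_pos hq
    (lt_of_lt_of_le hε (weilGroundEnergy_anti hb0 (log_half_le_of_le_exp hq.pos h1)))

/-! ## The table: `c = 3/2, 8/5, 17/10, 2 ↦ q ≤ 19, 23, 29, 53` -/

/-- `c = 3/2` (both lineages custodian-VERIFIED in both sectors — a DATA object, not a tree fact): a strictly positive two-sector bracket at `3/2`
gives `0 < δ*(q)` for every prime `q ≤ 19` (`20 ≤ e³`). [this track] -/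
theorem forall_wallOffset_pos_of_sector_energies_3_2 (hev : 0 < weilEvenGroundEnergy (3 / 2)) (hod : 0 < weilOddGroundEnergy (3 / 2)) :
    ∀ q : ℕ, q.Prime → q ≤ 20 → 0 < wallOffset q :=
  forall_wallOffset_pos_of_sector_energies
    (natCast_le_exp_of_pow_lt (P := 20) (n := 1) (m := 3) (by norm_num) (by norm_num) (by norm_num)) hev hod

/-- `c = 8/5`: a strictly positive two-sector bracket at `8/5` gives `0 < δ*(q)` for every prime `q ≤ 23` (`24^5 < e^{16}`). [this track] -/
theorem forall_wallOffset_pos_of_sector_energies_8_5 (hev : 0 < weilEvenGroundEnergy (8 / 5)) (hod : 0 < weilOddGroundEnergy (8 / 5)) :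
    ∀ q : ℕ, q.Prime → q ≤ 24 → 0 < wallOffset q :=
  forall_wallOffset_pos_of_sector_energies
    (natCast_le_exp_of_pow_lt (P := 24) (n := 5) (m := 16) (by norm_num) (by norm_num) (by norm_num)) hev hod

/-- `c = 17/10`: a strictly positive two-sector bracket at `17/10` gives `0 < δ*(q)` for every prime `q ≤ 29` (`29^5 < e^{17}`). [this track] -/
theorem forall_wallOffset_pos_of_sector_energies_17_10 (hev : 0 < weilEvenGroundEnergy (17 / 10))
    (hod : 0 < weilOddGroundEnergy (17 / 10)) : ∀ q : ℕ, q.Prime → q ≤ 29 → 0 < wallOffset q :=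
  forall_wallOffset_pos_of_sector_energies
    (natCast_le_exp_of_pow_lt (P := 29) (n := 5) (m := 17) (by norm_num) (by norm_num) (by norm_num)) hev hod

/-- `c = 2`: a strictly positive two-sector bracket at `2` gives `0 < δ*(q)` for every prime `q ≤ 53` (`54 < e⁴`). [this track] -/
theorem forall_wallOffset_pos_of_sector_energies_two (hev : 0 < weilEvenGroundEnergy 2) (hod : 0 < weilOddGroundEnergy 2) :
    ∀ q : ℕ, q.Prime → q ≤ 54 → 0 < wallOffset q :=
  forall_wallOffset_pos_of_sector_energies
    (natCast_le_exp_of_pow_lt (P := 54) (n := 1) (m := 4) (by norm_num) (by norm_num) (by norm_num)) hev hod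

end Summit.RiemannHypothesis.RiemannHypothesis.Theorems.HandoffSemilocalSectorContinuity

end
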